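import Literature.Barriers.CriticalPhenomena.WeaklySAWSupersymmetricRepresentationAnalytic
import HarnessLib

/-!
# The forms `τ_{Δ,x}` of BBS 2015 and `Σ_x τ_{Δ,x} = φ(-Δ)φ̄ + ψ(-Δ)ψ̄` (eq. (3.11));
# the susceptibility `χ_N` as a sum of super-integrals

A faithfulness complement to the formalisation of Proposition 3.1 of Bauerschmidt–Brydges–Slade
(CMP 337 (2015), arXiv:1403.7422) in `WeaklySAWSupersymmetricRepresentation{,Analytic}.lean`, where
the kinetic factor of the integrand `e^{-Σ_x(τ_{Δ,x}+gτ_x²+ντ_x)}` is taken to be the super-Gaussian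
`superGauss (negLaplacianC d n) = e^{-φ(-Δ)φ̄}·exp(-ψ(-Δ)ψ̄)`. Here the source's forms are transcribed
literally and the identification is proved:

* `lapPhiBar`, `lapPhi`, `lapPsiBar`, `lapPsi` — `(-Δφ̄)_x`, `(-Δφ)_x`, `(-Δψ̄)_x`, `(-Δψ)_x`;
  **`tauDelta d n x = τ_{Δ,x} = ½(φ_x(-Δφ̄)_x + (-Δφ)_xφ̄_x + ψ_x(-Δψ̄)_x + (-Δψ)_xψ̄_x)`** (eq. (3.9));
* `torusStepMatrix_symm`, `negLaplacianC_symm` (`-Δ_Λ` is symmetric, `e ↦ -e`), and the four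
  summations by parts `sum_phi_lapPhiBar`, `sum_lapPhi_phiBar`, `sum_psi_lapPsiBar`, `sum_lapPsi_psiBar`;
* **`sum_tauDelta`** — eq. (3.11): `Σ_{x∈Λ}τ_{Δ,x} = φ(-Δ)φ̄ + ψ(-Δ)ψ̄`
  (`= ofFun (quadForm (-Δ)) + fermionAction (-Δ)`, the action `S_{-Δ}` of `WeaklySAWSuperGaussian.lean`),
  and `superGauss_negLaplacianC_eq` recording that `superGauss (negLaplacianC d n)` is by definition
  `e^{-φ(-Δ)φ̄}·exp(-ψ(-Δ)ψ̄) = e^{-Σ_xτ_{Δ,x}}` (the exponential of the even form `Σ_xτ_{Δ,x}` in the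
  sense of (3.4)–(3.5): Taylor expansion about its degree-zero part `φ(-Δ)φ̄`);
* **`torusSusceptibility_eq_sum_superIntegral`**: `χ_N(ν) = Σ_{b∈Λ}∫e^{-Σ(τ_{Δ,x}+gτ_x²+ντ_x)}φ̄_0φ_b`
  for `g > 0` and every real `ν` (eq. (4.1) with Proposition 3.1).

Everything is proved; no named facts. (Technical: the pointwise `DecidableEq` instance on
`TorusSite d n = (Fin d → ZMod n)` is disabled in the second half of the file so that the generators
`ψ_x, ψ̄_x` are elaborated with the instance underlying the enumeration order `instLinearOrderTorusSite`,
as in the generic files.)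
-/

noncomputable section

open MeasureTheory Filter Topology Set Complex ComplexConjugate
open scoped ENNReal
open Literature.Probability.LatticeModels
open Literature.MathematicalPhysics.QuantumLattice
open scoped BigOperators

namespace Literature.Barriers.CriticalPhenomena

namespace CTWSAW

variable {d n : ℕ} [NeZero n]

/-! ### Symmetry of `-Δ_Λ` -/

omit [NeZero n] in
/-- Reversing a direction negates the folded step. [folklore] -/
theorem torusStep_neg (e : SRW.Dir d) : torusStep n e.neg = -torusStep (d := d) n e := by
  unfold torusStep
  rw [SRW.stepVec_neg]
  funext j; simp [Torus.proj_apply]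

omit [NeZero n] in
/-- The step matrix of the torus is symmetric (`e ↦ -e`). [folklore] -/
theorem torusStepMatrix_symm (y y' : TorusSite d n) : torusStepMatrix d n y y' = torusStepMatrix d n y' y := by
  rw [torusStepMatrix_apply, torusStepMatrix_apply]
  refine (Function.Bijective.sum_comp SRW.Dir.neg_bijective
    (fun e => if y' = y + torusStep n e then (1 : ℝ) else 0)).symm.trans ?_
  refine Finset.sum_congr rfl fun e _ => ?_
  simp only [torusStep_neg]
  congr 1
  apply propext
  constructor
  · intro h; rw [h]; abel
  · intro h; rw [h]; abel

omit [NeZero n] in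
/-- **`-Δ_Λ` is symmetric.** [folklore] -/
theorem negLaplacianC_symm (x y : TorusSite d n) : negLaplacianC d n x y = negLaplacianC d n y x := by
  simp only [negLaplacianC, schrodingerMatrixC, Matrix.sub_apply, Matrix.diagonal_apply, torusStepMatrixC,
    Matrix.map_apply, torusStepMatrix_symm x y]
  by_cases h : x = y
  · subst h; rfl
  · rw [if_neg h, if_neg (Ne.symm h)]

/-! ### The forms `τ_{Δ,x}` -/

-- The Grassmann generators `psi`/`psiBar` of the generic files are elaborated with the `DecidableEq`
-- instance underlying `LinearOrder Λ`; on `Λ = TorusSite d n` we must use the same one (and not the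
-- pointwise `Fintype.decidablePiFintype`), so the latter is disabled from here on.
attribute [-instance] Fintype.decidablePiFintype

/-- `(-Δφ̄)_x = Σ_y (-Δ)_{xy} φ̄_y` (a `0`-form). [cite: BauerschmidtBrydgesSlade2015LogCorr, §3.3, eq. (3.9)] -/
def lapPhiBar (d n : ℕ) [NeZero n] (x : TorusSite d n) : FieldFun (TorusSite d n) :=
  fun φ => ∑ y, negLaplacianC d n x y * conj (φ y)

/-- `(-Δφ)_x = Σ_y (-Δ)_{xy} φ_y` (a `0`-form). [cite: BauerschmidtBrydgesSlade2015LogCorr, §3.3, eq. (3.9)] -/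
def lapPhi (d n : ℕ) [NeZero n] (x : TorusSite d n) : FieldFun (TorusSite d n) :=
  fun φ => ∑ y, negLaplacianC d n x y * φ y

/-- `(-Δψ̄)_x = Σ_y (-Δ)_{xy} ψ̄_y` (a `1`-form). [cite: BauerschmidtBrydgesSlade2015LogCorr, §3.3, eq. (3.9)] -/
def lapPsiBar (d n : ℕ) [NeZero n] (x : TorusSite d n) : SForm (TorusSite d n) :=
  ∑ y, (constFun (negLaplacianC d n x y) : FieldFun (TorusSite d n)) • psiBar (FieldFun (TorusSite d n)) y

/-- `(-Δψ)_x = Σ_y (-Δ)_{xy} ψ_y` (a `1`-form). [cite: BauerschmidtBrydgesSlade2015LogCorr, §3.3, eq. (3.9)] -/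
def lapPsi (d n : ℕ) [NeZero n] (x : TorusSite d n) : SForm (TorusSite d n) :=
  ∑ y, (constFun (negLaplacianC d n x y) : FieldFun (TorusSite d n)) • psi (FieldFun (TorusSite d n)) y

/-- **`τ_{Δ,x} = ½(φ_x(-Δφ̄)_x + (-Δφ)_xφ̄_x + ψ_x(-Δψ̄)_x + (-Δψ)_xψ̄_x)`** (the symmetrised kinetic
form). [cite: BauerschmidtBrydgesSlade2015LogCorr, §3.3, eq. (3.9)] -/
def tauDelta (d n : ℕ) [NeZero n] (x : TorusSite d n) : SForm (TorusSite d n) :=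
  (2 : ℂ)⁻¹ • (ofFun (fun φ => φ x * lapPhiBar d n x φ) + ofFun (fun φ => lapPhi d n x φ * conj (φ x)) +
    psi (FieldFun (TorusSite d n)) x * lapPsiBar d n x + lapPsi d n x * psiBar (FieldFun (TorusSite d n)) x)

/-- `Σ_x φ_x(-Δφ̄)_x = φ(-Δ)φ̄`. [folklore] -/
theorem sum_phi_lapPhiBar (φ : TorusSite d n → ℂ) :
    ∑ x, φ x * lapPhiBar d n x φ = Boson.quadForm (negLaplacianC d n) φ := by
  unfold lapPhiBar Boson.quadForm
  refine Finset.sum_congr rfl fun x _ => ?_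
  rw [Finset.mul_sum]
  exact Finset.sum_congr rfl fun y _ => by ring

/-- `Σ_x (-Δφ)_x φ̄_x = φ(-Δ)φ̄` (summation by parts = symmetry of `-Δ`). [cite: BauerschmidtBrydgesSlade2015LogCorr, §3.3, eq. (3.11)] -/
theorem sum_lapPhi_phiBar (φ : TorusSite d n → ℂ) :
    ∑ x, lapPhi d n x φ * conj (φ x) = Boson.quadForm (negLaplacianC d n) φ := by
  unfold lapPhi Boson.quadForm
  simp_rw [Finset.sum_mul]
  rw [Finset.sum_comm]
  refine Finset.sum_congr rfl fun x _ => Finset.sum_congr rfl fun y _ => ?_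
  rw [negLaplacianC_symm y x]; ring

/-- `Σ_x ψ_x(-Δψ̄)_x = ψ(-Δ)ψ̄`. [folklore] -/
theorem sum_psi_lapPsiBar :
    ∑ x, psi (FieldFun (TorusSite d n)) x * lapPsiBar d n x = fermionAction (negLaplacianC d n) := by
  unfold lapPsiBar fermionAction
  refine Finset.sum_congr rfl fun x _ => ?_
  rw [Finset.mul_sum]
  refine Finset.sum_congr rfl fun y _ => ?_
  rw [mul_smul_comm]

/-- `Σ_x (-Δψ)_x ψ̄_x = ψ(-Δ)ψ̄` (summation by parts = symmetry of `-Δ`). [cite: BauerschmidtBrydgesSlade2015LogCorr, §3.3, eq. (3.11)] -/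
theorem sum_lapPsi_psiBar :
    ∑ x, lapPsi d n x * psiBar (FieldFun (TorusSite d n)) x = fermionAction (negLaplacianC d n) := by
  unfold lapPsi fermionAction
  simp_rw [Finset.sum_mul, smul_mul_assoc]
  rw [Finset.sum_comm]
  refine Finset.sum_congr rfl fun x _ => Finset.sum_congr rfl fun y _ => ?_
  rw [negLaplacianC_symm y x]

/-- **Eq. (3.11) of BBS 2015: `Σ_{x∈Λ} τ_{Δ,x} = Σ_x(φ_x(-Δφ̄)_x + ψ_x(-Δψ̄)_x) = φ(-Δ)φ̄ + ψ(-Δ)ψ̄ = S_{-Δ}`**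
(summation by parts on the torus), so that `e^{-Σ_xτ_{Δ,x}} = e^{-S_{-Δ_Λ}}` is the super-Gaussian
`superGauss (negLaplacianC d n)` of `WeaklySAWSuperGaussian.lean` (by its definition
`superGauss B = e^{-φBφ̄}·exp(-ψBψ̄)`, `superGauss_eq`). [cite: BauerschmidtBrydgesSlade2015LogCorr, §3.3, eq. (3.11)] -/
theorem sum_tauDelta :
    ∑ x, tauDelta d n x = ofFun (Boson.quadForm (negLaplacianC d n)) + fermionAction (negLaplacianC d n) := by
  have hofFun_sum : ∀ f : TorusSite d n → FieldFun (TorusSite d n),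
      (∑ x, ofFun (f x) : SForm (TorusSite d n)) = ofFun (∑ x, f x) := fun f => by
    unfold ofFun; exact (map_sum (algebraMap (FieldFun (TorusSite d n)) (SForm (TorusSite d n))) f _).symm
  unfold tauDelta
  rw [← Finset.smul_sum, Finset.sum_add_distrib, Finset.sum_add_distrib, Finset.sum_add_distrib,
    sum_psi_lapPsiBar, sum_lapPsi_psiBar, hofFun_sum, hofFun_sum]
  have h1 : (∑ x, fun φ : TorusSite d n → ℂ => φ x * lapPhiBar d n x φ) = Boson.quadForm (negLaplacianC d n) := by
    funext φ; rw [Finset.sum_apply]; exact sum_phi_lapPhiBar φ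
  have h2 : (∑ x, fun φ : TorusSite d n → ℂ => lapPhi d n x φ * conj (φ x)) = Boson.quadForm (negLaplacianC d n) := by
    funext φ; rw [Finset.sum_apply]; exact sum_lapPhi_phiBar φ
  rw [h1, h2]
  set Q : SForm (TorusSite d n) := ofFun (Boson.quadForm (negLaplacianC d n))
  set F : SForm (TorusSite d n) := fermionAction (negLaplacianC d n)
  have : Q + Q + F + F = (2 : ℂ) • (Q + F) := by rw [two_smul]; abel
  rw [this, smul_smul, inv_mul_cancel₀ two_ne_zero, one_smul]

/-- **`e^{-S_{-Δ_Λ}}` is literally `e^{-Σ_xτ_{Δ,x}}`**: with `S := Σ_xτ_{Δ,x}`, whose degree-zero part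
is `φ(-Δ)φ̄` (central) and whose nilpotent part is `ψ(-Δ)ψ̄`, the exponential
`e^{-S} = e^{-φ(-Δ)φ̄}·exp(-ψ(-Δ)ψ̄)` is `superGauss (negLaplacianC d n)`. [cite: BauerschmidtBrydgesSlade2015LogCorr, §3.2 (3.4)–(3.5) and §3.3 (3.11)] -/
theorem superGauss_negLaplacianC_eq :
    superGauss (negLaplacianC d n) =
      ofFun (fun φ => cexp (-(Boson.quadForm (negLaplacianC d n) φ))) *
        grassmannExp (-fermionAction (negLaplacianC d n)) := rfl

/-! ### The susceptibility as a sum of super-integrals -/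

/-- **`χ_N(ν) = Σ_{b∈Λ} ∫ e^{-Σ_x(τ_{Δ,x}+gτ_x²+ντ_x)} φ̄_0φ_b`** for `g > 0` and every real `ν`
(`χ_N = Σ_b G_{N,ν}(0,b)`, `torusSusceptibility_eq_sum_torusTwoPoint`, and Proposition 3.1 termwise) —
the starting point (4.1) of the analysis of `χ̂_N`. [cite: BauerschmidtBrydgesSlade2015LogCorr, §4.1, eq. (4.1) with Proposition 3.1] -/
theorem torusSusceptibility_eq_sum_superIntegral {g : ℝ} (hg : 0 < g) (ν : ℝ) :
    (((torusSusceptibility d n g ν).toReal : ℝ) : ℂ) =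
      ∑ b : TorusSite d n, superIntegral (ofFun (fun φ => φ b * conj (φ 0)) *
        (superGauss (negLaplacianC d n) * interactionForm g ν)) := by
  rw [torusSusceptibility_eq_sum_torusTwoPoint n g ν, ENNReal.toReal_sum fun b _ => ?_, Complex.ofReal_sum]
  · exact Finset.sum_congr rfl fun b _ => torusTwoPoint_eq_superIntegral_real hg ν b
  · have h := torusSusceptibility_lt_top (d := d) n hg ν
    rw [torusSusceptibility_eq_sum_torusTwoPoint n g ν] at h
    exact (lt_of_le_of_lt (Finset.single_le_sum (fun i _ => (bot_le : (0 : ℝ≥0∞) ≤ torusTwoPoint d n g ν i))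
      (Finset.mem_univ b)) h).ne

end CTWSAW

end Literature.Barriers.CriticalPhenomena
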